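import Summits.CriticalPhenomena.SAWScalingLimit.Theorems.SAWCompassLatticeSurfaceUniversalityNonVacuity
import Summits.CriticalPhenomena.SAWScalingLimit.Theorems.SAWDevelopingMapHexTransferThirdBdryEndpoints
import Literature.Probability.RandomPlanarGeometry.SelfAvoidingWalk

/-!
# Groundwork for stub `stub_lipPlusPointIsZ2` (line `registered`, crux `SurfaceUniversality`,
# stmt-CriticalPhenomena-6964): the face discretisation of the square tiling is a SUB-discretisation
# of the canonical `δℤ²` discretisation of the same domain

Route `SAWCompassLattice` (sub-problem `SAWScalingLimit`). The stub `LipPlusPointIsZ2` of the lead's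
skeleton compares the critical `ℤ²` SAW law `SAW.law Ω δ` (sites `x` with `δ x ∈ Ω`, nearest-neighbour
edges whose closed rescaled segment lies in `closure Ω`, `DomainDiscretisation.lean`) with the critical
plus-lattice law on the faces of `meshFaces (π/2) Ω δ` (faces `(k, j)` whose closed rescaled square
`δ · [k, k+1] × [j - 1/2, j + 1/2]` lies in `Ω`, `YangBaxterSAWLaw.lean`). The face centres
`δ (k + 1/2 + j i)` form the half-period translate `δ(ℤ² + 1/2)`; but the map

  face `(k, j)` ↦ its WEST PORT `vert k j`, drawn at the lattice site `δ (k + j i) = meshPoint δ ![k, j]`,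

is a graph isomorphism of the face-adjacency structure of `ℤ × ℤ` onto `ℤ²` which lands INSIDE the
canonical discretisation, with no translation at the level of the lattice (the `δ/2` offset is only in
the drawing, and is free at bounded-Lipschitz level). This file proves the three facts making
"faces of `Ω_δ` ⊆ sites of `Ω_δ`, with all their adjacencies" precise:

* `vec_mem_meshVertices_of_mem_meshFaces`, `vec_succ_mem_meshVertices_of_mem_meshFaces` — the west and
  east port sites `![k, j]`, `![k + 1, j]` of a face `(k, j)` of `Ω_δ` are mesh vertices of `Ω_δ`;
* `meshGraph_adj_of_mem_meshFaces` — they are joined in the mesh graph (the segment is the horizontal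
  midline of the square);
* `meshGraph_adj_of_mem_meshFaces_of_mem_meshFaces` — for two vertically adjacent faces `(k, j)`,
  `(k, j + 1)` of `Ω_δ` the west port sites `![k, j]`, `![k, j + 1]` are joined in the mesh graph (the
  segment is the union of two half-sides).

Hence the image of any face component of `meshFaces (π/2) Ω δ` is a connected INDUCED subgraph of the
mesh vertex graph `meshVertexGraph Ω δ`, and the sites NOT coming from faces form one partial boundary
layer (those `x` with `δ x ∈ Ω` whose closed square `δ([x₀, x₀+1] × [x₁-1/2, x₁+1/2])` leaves `Ω`, at
distance `≤ δ√5/2` from `∂Ω`): the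
discretisation change in `LipPlusPointIsZ2` is ONE-SIDED (inward trimming), so the exact SAW restriction
identity `law_F = law_Ω( · | γ ⊂ F)` applies on the common largest component (analysis note
`Cruxes/SurfaceUniversality/Lines/birth-lipPlusPointIsZ2-analysis.md`).

Finally `lipEndpointRobust_of_lipPlusPointIsZ2` calibrates the stub: since port endpoint approximations at
`Θ ≡ π/2` exist for every Dobrushin domain (`ybBdryEndpoints_of_mem_Icc`, landed), two instances of
`LipPlusPointIsZ2` (stated UNFOLDED, over the `PortGadget.pathLaw plusLattice …` term) sharing the port
approximation subtract to bounded-Lipschitz ENDPOINT ROBUSTNESS of the critical `ℤ²` law — item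
stmt-CriticalPhenomena-0776 `SAWConfRestriction.EndpointRobust` restricted to Lipschitz test functions. So
that open guard item (Lipschitz form) is necessary for the stub.
-/

noncomputable section

namespace Summit.CriticalPhenomena.SAWScalingLimit.Theorems.SurfaceUniversality

open Set MeasureTheory Filter Topology
open scoped NNReal
open Literature.Probability.LatticeModels
open Literature.Probability.RandomPlanarGeometry
open Literature.Probability.RandomPlanarGeometry.SAW
open Literature.Probability.RandomPlanarGeometry.SAW.YangBaxter
open Summit.CriticalPhenomena.SAWScalingLimit.Cruxes.HexTransfer.Sketch.Surface (planeCorner_rightAngles)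
open Summit.CriticalPhenomena.SAWScalingLimit.Cruxes.HexTransfer.YbRelay (ybBdryEndpoints_of_mem_Icc)
open Complex (I)

/-! ### The square tiling at right angles: ports sit at lattice sites -/

/-- At right angles the midpoint of the vertical edge `vert k j` (the west side of the face `(k, j)`)
is the integer point `k + j i`. -/
theorem planeMidpoint_rightAngles_vert (k j : ℤ) :
    planeMidpoint rightAngles (.vert k j) = (k : ℂ) + (j : ℂ) * I := by
  simp only [planeMidpoint, planeCorner_rightAngles]
  ring

/-- The mesh point of the site `![k, j]` is `δ (k + j i)`. -/
theorem meshPoint_vec (δ : ℝ) (k j : ℤ) :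
    meshPoint δ ![k, j] = (δ : ℂ) * ((k : ℂ) + (j : ℂ) * I) := by
  have h : Site.toComplex ![k, j] = (k : ℂ) + (j : ℂ) * I := by
    apply Complex.ext <;> simp [Site.toComplex]
  rw [meshPoint, h]

/-- The mesh point of the site `![k, j]` is the rescaled west port of the face `(k, j)`. -/
theorem meshPoint_vec_eq_planeMidpoint (δ : ℝ) (k j : ℤ) :
    meshPoint δ ![k, j] = (δ : ℂ) * planeMidpoint rightAngles (.vert k j) := by
  rw [meshPoint_vec, planeMidpoint_rightAngles_vert]

/-- A rescaled segment between two points of the closed square of a face of `Ω_δ` lies in `Ω`. -/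
theorem segment_subset_of_mem_rhombus {Θ : ℤ → ℝ} {Ω : Set ℂ} {δ : ℝ} {f : Face}
    (hf : f ∈ meshFaces Θ Ω δ) {p q : ℂ} (hp : p ∈ rhombus Θ f) (hq : q ∈ rhombus Θ f) :
    segment ℝ ((δ : ℂ) * p) ((δ : ℂ) * q) ⊆ Ω := by
  rintro _ ⟨s, t, hs, ht, hst, rfl⟩
  have hz : s • p + t • q ∈ rhombus Θ f := convex_rhombus Θ f hp hq hs ht hst
  have := hf _ hz
  convert this using 1
  simp only [Complex.real_smul, mul_add]
  ring

/-! ### Faces of `Ω_δ` give mesh vertices of `Ω_δ` -/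

/-- **The west port site of a face of `Ω_δ` is a mesh vertex of `Ω_δ`**: if the closed square of
`(k, j)` rescaled by `δ` lies in `Ω`, then `δ (k + j i) ∈ Ω`. -/
theorem vec_mem_meshVertices_of_mem_meshFaces {Ω : Set ℂ} {δ : ℝ} {k j : ℤ}
    (hf : ((k, j) : Face) ∈ meshFaces rightAngles Ω δ) : (![k, j] : Site 2) ∈ meshVertices Ω δ := by
  rw [mem_meshVertices_iff, meshPoint_vec_eq_planeMidpoint]
  exact hf _ (planeMidpoint_side_mem_rhombus rightAngles (k, j) .W)

/-- **The east port site of a face of `Ω_δ` is a mesh vertex of `Ω_δ`.** -/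
theorem vec_succ_mem_meshVertices_of_mem_meshFaces {Ω : Set ℂ} {δ : ℝ} {k j : ℤ}
    (hf : ((k, j) : Face) ∈ meshFaces rightAngles Ω δ) :
    (![k + 1, j] : Site 2) ∈ meshVertices Ω δ := by
  rw [mem_meshVertices_iff, meshPoint_vec_eq_planeMidpoint]
  exact hf _ (planeMidpoint_side_mem_rhombus rightAngles (k, j) .E)

/-! ### Faces of `Ω_δ` give mesh edges of `Ω_δ` -/

/-- The east port site is the lattice neighbour of the west port site in direction `0`. -/
theorem vec_succ_eq_add_single (k j : ℤ) :
    (![k + 1, j] : Site 2) = ![k, j] + Pi.single (0 : Fin 2) 1 := by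
  funext i
  fin_cases i <;> simp

/-- The west port site of the face above is the lattice neighbour in direction `1`. -/
theorem vec_succ_eq_add_single' (k j : ℤ) :
    (![k, j + 1] : Site 2) = ![k, j] + Pi.single (1 : Fin 2) 1 := by
  funext i
  fin_cases i <;> simp

/-- **The west and east port sites of a face of `Ω_δ` are joined in the mesh graph**: the closed
segment between them is the horizontal midline of the closed square, which lies in `Ω ⊆ closure Ω`. -/
theorem meshGraph_adj_of_mem_meshFaces {Ω : Set ℂ} {δ : ℝ} {k j : ℤ}
    (hf : ((k, j) : Face) ∈ meshFaces rightAngles Ω δ) :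
    (meshGraph Ω δ).Adj ![k, j] ![k + 1, j] := by
  refine meshGraph_adj_iff.2 ⟨(zdGraph_adj_iff _ _).2 ⟨0, Or.inl (vec_succ_eq_add_single k j)⟩, ?_⟩
  rw [meshPoint_vec_eq_planeMidpoint, meshPoint_vec_eq_planeMidpoint]
  exact (segment_subset_of_mem_rhombus hf (planeMidpoint_side_mem_rhombus rightAngles (k, j) .W)
    (planeMidpoint_side_mem_rhombus rightAngles (k, j) .E)).trans subset_closure

/-- The rescaled vertical segment from the west port of `(k, j)` to the west port of `(k, j + 1)`
lies in `Ω` when both faces belong to `Ω_δ`: its lower half is the upper half of the west side of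
`(k, j)`, its upper half the lower half of the west side of `(k, j + 1)`. -/
theorem segment_subset_of_mem_meshFaces_of_mem_meshFaces {Ω : Set ℂ} {δ : ℝ} {k j : ℤ}
    (hf : ((k, j) : Face) ∈ meshFaces rightAngles Ω δ)
    (hf' : ((k, j + 1) : Face) ∈ meshFaces rightAngles Ω δ) :
    segment ℝ (meshPoint δ ![k, j]) (meshPoint δ ![k, j + 1]) ⊆ Ω := by
  rintro z ⟨s, t, hs, ht, hst, rfl⟩
  rw [meshPoint_vec, meshPoint_vec]
  -- the corner shared by the two west sides
  have hc : planeCorner rightAngles (k, j) + I = (k : ℂ) + ((j : ℂ) + 1 / 2) * I := by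
    rw [planeCorner_rightAngles]; ring
  have hc' : planeCorner rightAngles (k, j + 1) = (k : ℂ) + ((j : ℂ) + 1 / 2) * I := by
    rw [planeCorner_rightAngles]; push_cast; ring
  have hW : planeMidpoint rightAngles (.vert k j) = (k : ℂ) + (j : ℂ) * I :=
    planeMidpoint_rightAngles_vert k j
  have hW' : planeMidpoint rightAngles (.vert k (j + 1)) = (k : ℂ) + ((j : ℂ) + 1) * I := by
    rw [planeMidpoint_rightAngles_vert]; push_cast; ring
  rcases le_total t (1 / 2) with h | h
  · -- lower half: a convex combination of the west port and the north-west corner of `(k, j)`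
    have hp : planeMidpoint rightAngles (.vert k j) ∈ rhombus rightAngles (k, j) :=
      planeMidpoint_side_mem_rhombus rightAngles (k, j) .W
    have hq : planeCorner rightAngles (k, j) + I ∈ rhombus rightAngles (k, j) :=
      cornerSet_subset_rhombus _ _ (by simp [cornerSet])
    have hmem : (1 - 2 * t) • planeMidpoint rightAngles (.vert k j) +
        (2 * t) • (planeCorner rightAngles (k, j) + I) ∈ rhombus rightAngles (k, j) :=
      convex_rhombus rightAngles (k, j) hp hq (by linarith) (by linarith) (by ring)
    have := hf _ hmem
    convert this using 1
    rw [hW, hc]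
    simp only [Complex.real_smul]
    obtain rfl : s = 1 - t := by linarith
    push_cast
    ring
  · -- upper half: a convex combination of the south-west corner and the west port of `(k, j + 1)`
    have hp : planeCorner rightAngles (k, j + 1) ∈ rhombus rightAngles (k, j + 1) :=
      cornerSet_subset_rhombus _ _ (by simp [cornerSet])
    have hq : planeMidpoint rightAngles (.vert k (j + 1)) ∈ rhombus rightAngles (k, j + 1) :=
      planeMidpoint_side_mem_rhombus rightAngles (k, j + 1) .W
    have hmem : (2 - 2 * t) • planeCorner rightAngles (k, j + 1) +
        (2 * t - 1) • planeMidpoint rightAngles (.vert k (j + 1)) ∈ rhombus rightAngles (k, j + 1) :=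
      convex_rhombus rightAngles (k, j + 1) hp hq (by linarith) (by linarith) (by ring)
    have := hf' _ hmem
    convert this using 1
    rw [hW', hc']
    simp only [Complex.real_smul]
    obtain rfl : s = 1 - t := by linarith
    push_cast
    ring

/-- **The west port sites of two vertically adjacent faces of `Ω_δ` are joined in the mesh graph.** -/
theorem meshGraph_adj_of_mem_meshFaces_of_mem_meshFaces {Ω : Set ℂ} {δ : ℝ} {k j : ℤ}
    (hf : ((k, j) : Face) ∈ meshFaces rightAngles Ω δ)
    (hf' : ((k, j + 1) : Face) ∈ meshFaces rightAngles Ω δ) :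
    (meshGraph Ω δ).Adj ![k, j] ![k, j + 1] :=
  meshGraph_adj_iff.2 ⟨(zdGraph_adj_iff _ _).2 ⟨1, Or.inl (vec_succ_eq_add_single' k j)⟩,
    (segment_subset_of_mem_meshFaces_of_mem_meshFaces hf hf').trans subset_closure⟩

/-! ### The induced-subgraph statement -/

/-- **Faces of `Ω_δ` are sites of `Ω_δ`, with all their adjacencies** (square tiling): the west port
sites of two faces of `Ω_δ` sharing a side are mesh vertices of `Ω_δ` joined in the mesh vertex graph
`meshVertexGraph Ω δ = (meshGraph Ω δ).induce (meshVertices Ω δ)`. Here "sharing a side" is spelled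
out as the four lattice moves. -/
theorem meshVertexGraph_adj_of_mem_meshFaces {Ω : Set ℂ} {δ : ℝ} {f g : Face}
    (hf : f ∈ meshFaces rightAngles Ω δ) (hg : g ∈ meshFaces rightAngles Ω δ)
    (hfg : g = (f.1 + 1, f.2) ∨ f = (g.1 + 1, g.2) ∨ g = (f.1, f.2 + 1) ∨ f = (g.1, g.2 + 1)) :
    (meshVertexGraph Ω δ).Adj
      ⟨![f.1, f.2], vec_mem_meshVertices_of_mem_meshFaces (k := f.1) (j := f.2) hf⟩
      ⟨![g.1, g.2], vec_mem_meshVertices_of_mem_meshFaces (k := g.1) (j := g.2) hg⟩ := by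
  obtain ⟨k, j⟩ := f
  obtain ⟨k', j'⟩ := g
  simp only [SimpleGraph.induce_adj]
  rcases hfg with h | h | h | h
  · obtain ⟨rfl, rfl⟩ := Prod.mk.inj h
    exact meshGraph_adj_of_mem_meshFaces hf
  · obtain ⟨rfl, rfl⟩ := Prod.mk.inj h
    exact (meshGraph_adj_of_mem_meshFaces hg).symm
  · obtain ⟨rfl, rfl⟩ := Prod.mk.inj h
    exact meshGraph_adj_of_mem_meshFaces_of_mem_meshFaces hf hg
  · obtain ⟨rfl, rfl⟩ := Prod.mk.inj h
    exact (meshGraph_adj_of_mem_meshFaces_of_mem_meshFaces hg hf).symm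

/-! ### Calibration: the stub contains bounded-Lipschitz endpoint robustness of the `ℤ²` law -/

/-- **`LipPlusPointIsZ2` (unfolded) implies bounded-Lipschitz endpoint robustness of the critical `ℤ²`
SAW law** (item stmt-CriticalPhenomena-0776 `SAWConfRestriction.EndpointRobust` restricted to Lipschitz
test functions): for every Dobrushin domain some port endpoint approximation at `Θ ≡ π/2` exists
(`ybBdryEndpoints_of_mem_Icc` at `θ = π/2 ∈ [π/3, 2π/3]`), and the two instances of the hypothesis for
`(a, b)` and `(u, v)` against that common plus law subtract. -/
theorem lipEndpointRobust_of_lipPlusPointIsZ2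
    (h : ∀ (D : DobrushinDomain) (a b : ℝ → Site 2) (a' b' : ℝ → MidEdge),
      SAW.IsEndpointApprox D a b → IsYBEndpointApprox rightAngles D a' b' →
      ∀ (f : BoundedContinuousFunction (CurveClass ℂ) ℝ) (L : ℝ≥0), LipschitzWith L f →
        Tendsto (fun δ : ℝ => (∫ γ, f γ.curve ∂(SAW.law D.carrier δ (a δ) (b δ))) -
            ∫ x, f x ∂(PortGadget.pathLaw plusLattice (plusFugacity (Real.sqrt SAW.criticalFugacity))
              (PortGadget.embed plusPos) (PortGadget.inFaces (meshFaces rightAngles D.carrier δ)) δ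
              (Sum.inl (a' δ)) (Sum.inl (b' δ))))
          (𝓝[>] (0 : ℝ)) (𝓝 0))
    (D : DobrushinDomain) (a b u v : ℝ → Site 2) (hab : SAW.IsEndpointApprox D a b)
    (huv : SAW.IsEndpointApprox D u v) (f : BoundedContinuousFunction (CurveClass ℂ) ℝ) (L : ℝ≥0)
    (hf : LipschitzWith L f) :
    Tendsto (fun δ : ℝ => (∫ γ, f γ.curve ∂(SAW.law D.carrier δ (a δ) (b δ))) -
        ∫ γ, f γ.curve ∂(SAW.law D.carrier δ (u δ) (v δ))) (𝓝[>] (0 : ℝ)) (𝓝 0) := by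
  obtain ⟨a', b', hab', -⟩ := ybBdryEndpoints_of_mem_Icc (Real.pi / 2)
    ⟨by linarith [Real.pi_pos], by linarith [Real.pi_pos]⟩ D
  have h1 := h D a b a' b' hab hab' f L hf
  have h2 := h D u v a' b' huv hab' f L hf
  have h12 := h1.sub h2
  rw [sub_zero] at h12
  exact h12.congr fun δ => by ring

/-- Registered groundwork stub `facesSubDiscretisation` of the crux (one-line signature): **faces of
`Ω_δ` are sites of `Ω_δ` with all their adjacencies** — the west port site of a face of
`meshFaces (π/2) Ω δ` is a mesh vertex, joined in the mesh graph to the east port site, and to the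
west port site of the face above when that face is in `Ω_δ` too. -/
theorem facesSubDiscretisation : ∀ (Ω : Set ℂ) (δ : ℝ) (k j : ℤ), ((k, j) : Face) ∈ meshFaces rightAngles Ω δ → (![k, j] : Site 2) ∈ meshVertices Ω δ ∧ (meshGraph Ω δ).Adj ![k, j] ![k + 1, j] ∧ (((k, j + 1) : Face) ∈ meshFaces rightAngles Ω δ → (meshGraph Ω δ).Adj ![k, j] ![k, j + 1]) :=
  fun _ _ _ _ hf => ⟨vec_mem_meshVertices_of_mem_meshFaces hf, meshGraph_adj_of_mem_meshFaces hf,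
    fun hf' => meshGraph_adj_of_mem_meshFaces_of_mem_meshFaces hf hf'⟩

end Summit.CriticalPhenomena.SAWScalingLimit.Theorems.SurfaceUniversality

end
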